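/-
Copyright: rh-split cell, seat prover-l1-w2 (L1 «DUST WALL», width seat 2), 2026-08-27.  ζ-free analysis.
Nothing here bears on the truth of RH.
-/
import Summits.RiemannHypothesis.RiemannHypothesis.Theorems.Splittings.ScrewDustCycleGaussA
import HarnessLib

/-!
# Gauss's law for GRID CYCLES — part B: no inside pole in any cell of a wall-free cell complex

ζ-free kernel theorem for the line X-11 «DUST WALL» (route `ScrewDustWall`, crux
`PointComponentInvisible`, stmt-RiemannHypothesis-21690) and for the cycle row `CycleEncirclable`.
Data as in `ScrewBorelContinuation`: `c : ι → ℂ` absolutely summable with `Re (c i) < 0`, `u i ≠ 0`,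
the Borel series `B = ∑' i, term (c i) (u i)`, its inside pole set `poleSet u ⊆ 𝔻`, and `F`
holomorphic on `𝔻` equal to `B` on a pole-free disc `ball 0 r₀`.

* `cellComplex_slopeCharge_eq_zero` (§3): for a finite complex `H` of closed grid cells inside `𝔻` in
  general position (each pole `u i`, `(u i)⁻¹` in an open cell or off the closed cell) whose EXPOSED
  edges lie in a preconnected `V ∋ 0`, `V ⊆ 𝔻 ∖ closure (poleSet u)`, the total PURE charge
  `∑' i, ∑_{Q ∈ H} (c i/2)·#{q ∈ {(u i)⁻¹, u i} : q ∈ Q°}` vanishes: per cell Cauchy–Goursat for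
  `dslope F 0` and `rectBoundaryIntegral_slopeTerm`; internal edges cancel
  (`ScrewDustCellFlux.sum_rectBoundaryIntegral_eq`, prover-l1); on exposed edges `dslope F 0 = slope
  series` integrates termwise (part A).
* **`poleSet_inter_cello_eq_empty`** (§4, GAUSS'S LAW FOR GRID CYCLES): the real parts of the pure
  charges are `≤ 0`, and `< 0` at an enclosed pole, so NO inside pole lies in an open cell of such a
  complex — one cycle of any shape, no shrinking, no Tannery limit (the grid-cycle analogue of the
  circle law `ScrewBorelGauss.poleSet_inter_ball_eq_empty`); pointwise and component (`V = Ω₀`) forms.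

With prover-l1's Zoretti hull (a point-component pole adherent to `Ω₀` sits in an open cell of a small
complex with exposed edges in `Ω₀`) this closes `PointComponentInvisible` with ONE complex; with an
annulus grid it contains the circle law; it is the kernel of the cycle row `CEIL(h) ∧ CENC(h) ⟺ RH`.

No `sorry`, no new axioms, no definitions, no instances, no notation.
-/

set_option linter.dupNamespace false

namespace Summit.RiemannHypothesis.RiemannHypothesis.Theorems.Splittings.ScrewDust

open Complex Filter Topology Set Metric MeasureTheory
open scoped Real Interval Classical
open Summit.RiemannHypothesis.RiemannHypothesis.Theorems.Splittings.ScrewBorel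
open Summit.RiemannHypothesis.RiemannHypothesis.Theorems.Splittings.ScrewBorelFlux
open Summit.RiemannHypothesis.RiemannHypothesis.Theorems.Splittings.ScrewBorelGauss
open Literature.Analysis.Complex

/-! ## 3. The flux theorem for the slope series through a cell complex -/

/-- **Flux of the slope series through a grid cycle (ζ-free).**  `c` absolutely summable, `u i ≠ 0`,
`F` holomorphic on the unit disc and equal to the Borel series on a pole-free disc `ball 0 r₀`
(`r₀ ≤ ‖p‖` for every inside pole `p`); a grid `x, y : ℤ → ℝ` (non-decreasing) and a finite set `H`
of its cells, closed cells inside `𝔻`, no pole `u i`, `(u i)⁻¹` on an edge of a cell of `H`, and every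
EXPOSED edge of `H` inside a preconnected `V ∋ 0`, `V ⊆ 𝔻 ∖ closure (poleSet u)`.  Then the total
PURE charge enclosed by `H` vanishes: `∑' i, ∑_{Q ∈ H} (c i/2)·#{q ∈ {(u i)⁻¹, u i} : q ∈ Q°} = 0`. -/
theorem cellComplex_slopeCharge_eq_zero {ι : Type*} [Countable ι] {c u : ι → ℂ}
    (hc : Summable fun i ↦ ‖c i‖) (hu : ∀ i, u i ≠ 0) {F : ℂ → ℂ}
    (hF : DifferentiableOn ℂ F (ball 0 1)) {r₀ : ℝ} (hr₀ : 0 < r₀)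
    (hS : ∀ p ∈ poleSet u, r₀ ≤ ‖p‖)
    (hFB : EqOn F (fun z ↦ ∑' i, term (c i) (u i) z) (ball 0 r₀)) {V : Set ℂ}
    (hV : IsPreconnected V) (hV0 : (0 : ℂ) ∈ V) (hVsub : V ⊆ ball 0 1 \ closure (poleSet u))
    {x y : ℤ → ℝ} (hx : ∀ m, x m ≤ x (m + 1)) (hy : ∀ n, y n ≤ y (n + 1)) (H : Finset (ℤ × ℤ))
    (hH : ∀ k ∈ H, Icc (x k.1) (x (k.1 + 1)) ×ℂ Icc (y k.2) (y (k.2 + 1)) ⊆ ball (0 : ℂ) 1)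
    (hoff : ∀ i, ∀ k ∈ H, ∀ q : ℂ, q = u i ∨ q = (u i)⁻¹ →
      q ∈ Ioo (x k.1) (x (k.1 + 1)) ×ℂ Ioo (y k.2) (y (k.2 + 1)) ∨
        q ∉ Icc (x k.1) (x (k.1 + 1)) ×ℂ Icc (y k.2) (y (k.2 + 1)))
    (hbot : ∀ k ∈ H, (k.1, k.2 - 1) ∉ H →
      (fun t : ℝ ↦ (t : ℂ) + y k.2 * I) '' Icc (x k.1) (x (k.1 + 1)) ⊆ V)
    (htop : ∀ k ∈ H, (k.1, k.2 + 1) ∉ H →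
      (fun t : ℝ ↦ (t : ℂ) + y (k.2 + 1) * I) '' Icc (x k.1) (x (k.1 + 1)) ⊆ V)
    (hlef : ∀ k ∈ H, (k.1 - 1, k.2) ∉ H →
      (fun t : ℝ ↦ (x k.1 : ℂ) + t * I) '' Icc (y k.2) (y (k.2 + 1)) ⊆ V)
    (hrig : ∀ k ∈ H, (k.1 + 1, k.2) ∉ H →
      (fun t : ℝ ↦ (x (k.1 + 1) : ℂ) + t * I) '' Icc (y k.2) (y (k.2 + 1)) ⊆ V) :
    ∑' i, ∑ k ∈ H, ((if (u i)⁻¹ ∈ Ioo (x k.1) (x (k.1 + 1)) ×ℂ Ioo (y k.2) (y (k.2 + 1))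
        then c i / 2 else 0) +
      (if u i ∈ Ioo (x k.1) (x (k.1 + 1)) ×ℂ Ioo (y k.2) (y (k.2 + 1)) then c i / 2 else 0)) =
      0 := by
  -- (0) `G = dslope F 0` is holomorphic on the disc
  have hGd : DifferentiableOn ℂ (dslope F 0) (ball 0 1) :=
    (Complex.differentiableOn_dslope (ball_mem_nhds (0 : ℂ) one_pos)).2 hF
  -- (1) the cells: Cauchy–Goursat for `G`, residues for the slope terms
  have hG0 : ∑ k ∈ H, rectBoundaryIntegral (dslope F 0) (x k.1) (x (k.1 + 1)) (y k.2)
      (y (k.2 + 1)) = 0 :=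
    Finset.sum_eq_zero fun k hk ↦ rectBoundaryIntegral_eq_zero_of_subset_ball hGd
      (hx _) (hy _) (hH k hk)
  have hT : ∀ i, ∑ k ∈ H, rectBoundaryIntegral (slopeTerm (c i) (u i)) (x k.1) (x (k.1 + 1))
      (y k.2) (y (k.2 + 1)) = -(2 * π * I) * ∑ k ∈ H,
      ((if (u i)⁻¹ ∈ Ioo (x k.1) (x (k.1 + 1)) ×ℂ Ioo (y k.2) (y (k.2 + 1))
        then c i / 2 else 0) +
      (if u i ∈ Ioo (x k.1) (x (k.1 + 1)) ×ℂ Ioo (y k.2) (y (k.2 + 1)) then c i / 2 else 0)) := by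
    intro i
    rw [Finset.mul_sum]
    refine Finset.sum_congr rfl fun k hk ↦ ?_
    exact rectBoundaryIntegral_slopeTerm (hx _) (hy _) (hH k hk)
      (hoff i k hk _ (Or.inl rfl)) (hoff i k hk _ (Or.inr rfl))
  -- (2) exposed edges: termwise integration and `G = slope series`
  have hb : ∀ k ∈ H \ H.image (fun k : ℤ × ℤ ↦ (k.1, k.2 + 1)),
      HasSum (fun i ↦ ∫ t in x k.1..x (k.1 + 1), slopeTerm (c i) (u i) (t + y k.2 * I))
        (∫ t in x k.1..x (k.1 + 1), dslope F 0 (t + y k.2 * I)) := by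
    intro k hk
    rw [Finset.mem_sdiff, mem_image_up] at hk
    have hsub := hbot k hk.1 hk.2
    exact hasSum_integral_path_slope hc hu hF hr₀ hS hFB hV hV0 hVsub
      (γ := fun t : ℝ ↦ (t : ℂ) + y k.2 * I) (by fun_prop) (hx _) fun t ht ↦ hsub ⟨t, ht, rfl⟩
  have ht : ∀ k ∈ H.image (fun k : ℤ × ℤ ↦ (k.1, k.2 + 1)) \ H,
      HasSum (fun i ↦ ∫ t in x k.1..x (k.1 + 1), slopeTerm (c i) (u i) (t + y k.2 * I))
        (∫ t in x k.1..x (k.1 + 1), dslope F 0 (t + y k.2 * I)) := by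
    intro k hk
    rw [Finset.mem_sdiff] at hk
    obtain ⟨k', hk', rfl⟩ := Finset.mem_image.1 hk.1
    have hsub := htop k' hk' hk.2
    exact hasSum_integral_path_slope hc hu hF hr₀ hS hFB hV hV0 hVsub
      (γ := fun t : ℝ ↦ (t : ℂ) + y (k'.2 + 1) * I)
      (by fun_prop) (hx _) fun t ht ↦ hsub ⟨t, ht, rfl⟩
  have hr : ∀ k ∈ H.image (fun k : ℤ × ℤ ↦ (k.1 + 1, k.2)) \ H,
      HasSum (fun i ↦ ∫ t in y k.2..y (k.2 + 1), slopeTerm (c i) (u i) (x k.1 + t * I))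
        (∫ t in y k.2..y (k.2 + 1), dslope F 0 (x k.1 + t * I)) := by
    intro k hk
    rw [Finset.mem_sdiff] at hk
    obtain ⟨k', hk', rfl⟩ := Finset.mem_image.1 hk.1
    have hsub := hrig k' hk' hk.2
    exact hasSum_integral_path_slope hc hu hF hr₀ hS hFB hV hV0 hVsub
      (γ := fun t : ℝ ↦ (x (k'.1 + 1) : ℂ) + t * I)
      (by fun_prop) (hy _) fun t ht ↦ hsub ⟨t, ht, rfl⟩
  have hl : ∀ k ∈ H \ H.image (fun k : ℤ × ℤ ↦ (k.1 + 1, k.2)),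
      HasSum (fun i ↦ ∫ t in y k.2..y (k.2 + 1), slopeTerm (c i) (u i) (x k.1 + t * I))
        (∫ t in y k.2..y (k.2 + 1), dslope F 0 (x k.1 + t * I)) := by
    intro k hk
    rw [Finset.mem_sdiff, mem_image_rt] at hk
    have hsub := hlef k hk.1 hk.2
    exact hasSum_integral_path_slope hc hu hF hr₀ hS hFB hV hV0 hVsub
      (γ := fun t : ℝ ↦ (x k.1 : ℂ) + t * I)
      (by fun_prop) (hy _) fun t ht ↦ hsub ⟨t, ht, rfl⟩
  -- (3) the edge forms: `∑' i, (edge form of slopeTermᵢ) = edge form of G = ∑_Q ∮ G = 0`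
  have hE : HasSum (fun i ↦ ∑ k ∈ H, rectBoundaryIntegral (slopeTerm (c i) (u i)) (x k.1)
      (x (k.1 + 1)) (y k.2) (y (k.2 + 1)))
      (∑ k ∈ H, rectBoundaryIntegral (dslope F 0) (x k.1) (x (k.1 + 1)) (y k.2) (y (k.2 + 1))) := by
    simp only [sum_rectBoundaryIntegral_eq]
    exact ((hasSum_sum hb).sub (hasSum_sum ht)).add
      (((hasSum_sum hr).sub (hasSum_sum hl)).mul_left I)
  simp only [hT, hG0] at hE
  have h3 := hE.tsum_eq
  rw [tsum_mul_left] at h3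
  have h2pi : -(2 * π * I : ℂ) ≠ 0 := by
    refine neg_ne_zero.2 (mul_ne_zero (mul_ne_zero two_ne_zero ?_) I_ne_zero)
    exact_mod_cast Real.pi_ne_zero
  exact (mul_eq_zero.1 h3).resolve_left h2pi

/-! ## 4. Gauss's law for grid cycles -/

/-- **GAUSS'S LAW FOR GRID CYCLES (ζ-free).**  `c` absolutely summable with `Re (c i) < 0`, `u i ≠ 0`;
`F` holomorphic on the unit disc and equal to the Borel series on a pole-free disc `ball 0 r₀`.  Let
`H` be a finite complex of closed grid cells inside `𝔻`, in general position (each pole `u i`,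
`(u i)⁻¹` in an open cell or off the closed cell), all of whose EXPOSED edges lie in a preconnected set
`V ∋ 0`, `V ⊆ 𝔻 ∖ closure (poleSet u)`.  Then NO inside pole lies in an open cell of `H`. -/
theorem poleSet_inter_cello_eq_empty {ι : Type*} {c u : ι → ℂ}
    (hc : Summable fun i ↦ ‖c i‖) (hre : ∀ i, (c i).re < 0) (hu : ∀ i, u i ≠ 0) {F : ℂ → ℂ}
    (hF : DifferentiableOn ℂ F (ball 0 1)) {r₀ : ℝ} (hr₀ : 0 < r₀)
    (hS : ∀ p ∈ poleSet u, r₀ ≤ ‖p‖)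
    (hFB : EqOn F (fun z ↦ ∑' i, term (c i) (u i) z) (ball 0 r₀)) {V : Set ℂ}
    (hV : IsPreconnected V) (hV0 : (0 : ℂ) ∈ V) (hVsub : V ⊆ ball 0 1 \ closure (poleSet u))
    {x y : ℤ → ℝ} (hx : ∀ m, x m ≤ x (m + 1)) (hy : ∀ n, y n ≤ y (n + 1)) (H : Finset (ℤ × ℤ))
    (hH : ∀ k ∈ H, Icc (x k.1) (x (k.1 + 1)) ×ℂ Icc (y k.2) (y (k.2 + 1)) ⊆ ball (0 : ℂ) 1)
    (hoff : ∀ i, ∀ k ∈ H, ∀ q : ℂ, q = u i ∨ q = (u i)⁻¹ →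
      q ∈ Ioo (x k.1) (x (k.1 + 1)) ×ℂ Ioo (y k.2) (y (k.2 + 1)) ∨
        q ∉ Icc (x k.1) (x (k.1 + 1)) ×ℂ Icc (y k.2) (y (k.2 + 1)))
    (hbot : ∀ k ∈ H, (k.1, k.2 - 1) ∉ H →
      (fun t : ℝ ↦ (t : ℂ) + y k.2 * I) '' Icc (x k.1) (x (k.1 + 1)) ⊆ V)
    (htop : ∀ k ∈ H, (k.1, k.2 + 1) ∉ H →
      (fun t : ℝ ↦ (t : ℂ) + y (k.2 + 1) * I) '' Icc (x k.1) (x (k.1 + 1)) ⊆ V)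
    (hlef : ∀ k ∈ H, (k.1 - 1, k.2) ∉ H →
      (fun t : ℝ ↦ (x k.1 : ℂ) + t * I) '' Icc (y k.2) (y (k.2 + 1)) ⊆ V)
    (hrig : ∀ k ∈ H, (k.1 + 1, k.2) ∉ H →
      (fun t : ℝ ↦ (x (k.1 + 1) : ℂ) + t * I) '' Icc (y k.2) (y (k.2 + 1)) ⊆ V) :
    ∀ k ∈ H, poleSet u ∩ (Ioo (x k.1) (x (k.1 + 1)) ×ℂ Ioo (y k.2) (y (k.2 + 1))) = ∅ := by
  haveI : Countable ι := countable_of_summable_of_re_neg hc hre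
  have h0 := cellComplex_slopeCharge_eq_zero hc hu hF hr₀ hS hFB hV hV0 hVsub hx hy H hH hoff
    hbot htop hlef hrig
  intro k₀ hk₀
  refine Set.eq_empty_iff_forall_notMem.2 fun p hp ↦ ?_
  obtain ⟨hpS, hpk⟩ := hp
  obtain ⟨i₀, hi₀⟩ := hpS.2
  -- the summands, their summability, and the signs of their real parts
  set f : ι → ℂ := fun i ↦ ∑ k ∈ H,
    ((if (u i)⁻¹ ∈ Ioo (x k.1) (x (k.1 + 1)) ×ℂ Ioo (y k.2) (y (k.2 + 1)) then c i / 2 else 0) +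
      (if u i ∈ Ioo (x k.1) (x (k.1 + 1)) ×ℂ Ioo (y k.2) (y (k.2 + 1)) then c i / 2 else 0))
    with hf
  have hfs : Summable f := by
    refine Summable.of_norm_bounded (hc.mul_left (H.card : ℝ)) fun i ↦ ?_
    refine (norm_sum_le _ _).trans ?_
    calc ∑ k ∈ H, ‖(if (u i)⁻¹ ∈ Ioo (x k.1) (x (k.1 + 1)) ×ℂ Ioo (y k.2) (y (k.2 + 1))
            then c i / 2 else 0) +
          (if u i ∈ Ioo (x k.1) (x (k.1 + 1)) ×ℂ Ioo (y k.2) (y (k.2 + 1)) then c i / 2 else 0)‖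
        ≤ ∑ _k ∈ H, ‖c i‖ := Finset.sum_le_sum fun k _ ↦ norm_cellCharge_le _ _ _
      _ = (H.card : ℝ) * ‖c i‖ := by rw [Finset.sum_const, nsmul_eq_mul]
  have hre_f : ∀ i, (f i).re = ∑ k ∈ H,
      ((if (u i)⁻¹ ∈ Ioo (x k.1) (x (k.1 + 1)) ×ℂ Ioo (y k.2) (y (k.2 + 1)) then c i / 2 else 0) +
        (if u i ∈ Ioo (x k.1) (x (k.1 + 1)) ×ℂ Ioo (y k.2) (y (k.2 + 1))
          then c i / 2 else 0)).re := fun i ↦ Complex.re_sum _ _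
  have hnonpos : ∀ i, (f i).re ≤ 0 := fun i ↦ by
    rw [hre_f]
    exact Finset.sum_nonpos fun k _ ↦ re_cellCharge_nonpos (hre i) _ _
  have hneg : (f i₀).re < 0 := by
    rw [hre_f]
    have hk₀neg := re_cellCharge_neg (hre i₀) (U := Ioo (x k₀.1) (x (k₀.1 + 1)) ×ℂ
      Ioo (y k₀.2) (y (k₀.2 + 1))) hi₀ hpk
    have hsingle := Finset.single_le_sum (f := fun k : ℤ × ℤ ↦
      -((if (u i₀)⁻¹ ∈ Ioo (x k.1) (x (k.1 + 1)) ×ℂ Ioo (y k.2) (y (k.2 + 1)) then c i₀ / 2 else 0) +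
        (if u i₀ ∈ Ioo (x k.1) (x (k.1 + 1)) ×ℂ Ioo (y k.2) (y (k.2 + 1))
          then c i₀ / 2 else 0)).re)
      (fun k _ ↦ neg_nonneg.2 (re_cellCharge_nonpos (hre i₀) _ _)) hk₀
    rw [Finset.sum_neg_distrib] at hsingle
    linarith
  have hre_sum : Summable fun i ↦ (f i).re := (Complex.hasSum_re hfs.hasSum).summable
  have hlt : ∑' i, (f i).re < ∑' _ : ι, (0 : ℝ) :=
    hre_sum.tsum_lt_tsum hnonpos hneg summable_zero
  rw [tsum_zero, ← Complex.re_tsum hfs] at hlt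
  have h0' : ∑' i, f i = 0 := h0
  rw [h0', Complex.zero_re] at hlt
  exact lt_irrefl _ hlt

/-- **No enclosed pole**, pointwise form of `poleSet_inter_cello_eq_empty`: an inside pole in an open
cell of such a complex is a contradiction. -/
theorem false_of_cellComplex {ι : Type*} {c u : ι → ℂ}
    (hc : Summable fun i ↦ ‖c i‖) (hre : ∀ i, (c i).re < 0) (hu : ∀ i, u i ≠ 0) {F : ℂ → ℂ}
    (hF : DifferentiableOn ℂ F (ball 0 1)) {r₀ : ℝ} (hr₀ : 0 < r₀)
    (hS : ∀ p ∈ poleSet u, r₀ ≤ ‖p‖)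
    (hFB : EqOn F (fun z ↦ ∑' i, term (c i) (u i) z) (ball 0 r₀)) {V : Set ℂ}
    (hV : IsPreconnected V) (hV0 : (0 : ℂ) ∈ V) (hVsub : V ⊆ ball 0 1 \ closure (poleSet u))
    {x y : ℤ → ℝ} (hx : ∀ m, x m ≤ x (m + 1)) (hy : ∀ n, y n ≤ y (n + 1)) {H : Finset (ℤ × ℤ)}
    (hH : ∀ k ∈ H, Icc (x k.1) (x (k.1 + 1)) ×ℂ Icc (y k.2) (y (k.2 + 1)) ⊆ ball (0 : ℂ) 1)
    (hoff : ∀ i, ∀ k ∈ H, ∀ q : ℂ, q = u i ∨ q = (u i)⁻¹ →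
      q ∈ Ioo (x k.1) (x (k.1 + 1)) ×ℂ Ioo (y k.2) (y (k.2 + 1)) ∨
        q ∉ Icc (x k.1) (x (k.1 + 1)) ×ℂ Icc (y k.2) (y (k.2 + 1)))
    (hbot : ∀ k ∈ H, (k.1, k.2 - 1) ∉ H →
      (fun t : ℝ ↦ (t : ℂ) + y k.2 * I) '' Icc (x k.1) (x (k.1 + 1)) ⊆ V)
    (htop : ∀ k ∈ H, (k.1, k.2 + 1) ∉ H →
      (fun t : ℝ ↦ (t : ℂ) + y (k.2 + 1) * I) '' Icc (x k.1) (x (k.1 + 1)) ⊆ V)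
    (hlef : ∀ k ∈ H, (k.1 - 1, k.2) ∉ H →
      (fun t : ℝ ↦ (x k.1 : ℂ) + t * I) '' Icc (y k.2) (y (k.2 + 1)) ⊆ V)
    (hrig : ∀ k ∈ H, (k.1 + 1, k.2) ∉ H →
      (fun t : ℝ ↦ (x (k.1 + 1) : ℂ) + t * I) '' Icc (y k.2) (y (k.2 + 1)) ⊆ V)
    {p : ℂ} (hp : p ∈ poleSet u) {k : ℤ × ℤ} (hk : k ∈ H)
    (hpk : p ∈ Ioo (x k.1) (x (k.1 + 1)) ×ℂ Ioo (y k.2) (y (k.2 + 1))) : False := by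
  have h := poleSet_inter_cello_eq_empty hc hre hu hF hr₀ hS hFB hV hV0 hVsub hx hy H hH hoff hbot
    htop hlef hrig k hk
  have : p ∈ poleSet u ∩ (Ioo (x k.1) (x (k.1 + 1)) ×ℂ Ioo (y k.2) (y (k.2 + 1))) := ⟨hp, hpk⟩
  rw [h] at this
  exact this

/-- **Component form.**  With `V = Ω₀`, the connected component of `0` in `𝔻 ∖ closure (poleSet u)`:
a cell complex inside `𝔻` in general position whose exposed edges lie in `Ω₀` encloses no inside pole
in its open cells. -/
theorem poleSet_inter_cello_eq_empty_of_component {ι : Type*} {c u : ι → ℂ}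
    (hc : Summable fun i ↦ ‖c i‖) (hre : ∀ i, (c i).re < 0) (hu : ∀ i, u i ≠ 0) {F : ℂ → ℂ}
    (hF : DifferentiableOn ℂ F (ball 0 1)) {r₀ : ℝ} (hr₀ : 0 < r₀)
    (hS : ∀ p ∈ poleSet u, r₀ ≤ ‖p‖)
    (hFB : EqOn F (fun z ↦ ∑' i, term (c i) (u i) z) (ball 0 r₀))
    {x y : ℤ → ℝ} (hx : ∀ m, x m ≤ x (m + 1)) (hy : ∀ n, y n ≤ y (n + 1)) (H : Finset (ℤ × ℤ))
    (hH : ∀ k ∈ H, Icc (x k.1) (x (k.1 + 1)) ×ℂ Icc (y k.2) (y (k.2 + 1)) ⊆ ball (0 : ℂ) 1)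
    (hoff : ∀ i, ∀ k ∈ H, ∀ q : ℂ, q = u i ∨ q = (u i)⁻¹ →
      q ∈ Ioo (x k.1) (x (k.1 + 1)) ×ℂ Ioo (y k.2) (y (k.2 + 1)) ∨
        q ∉ Icc (x k.1) (x (k.1 + 1)) ×ℂ Icc (y k.2) (y (k.2 + 1)))
    (hbot : ∀ k ∈ H, (k.1, k.2 - 1) ∉ H →
      (fun t : ℝ ↦ (t : ℂ) + y k.2 * I) '' Icc (x k.1) (x (k.1 + 1)) ⊆
        connectedComponentIn (ball (0 : ℂ) 1 \ closure (poleSet u)) 0)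
    (htop : ∀ k ∈ H, (k.1, k.2 + 1) ∉ H →
      (fun t : ℝ ↦ (t : ℂ) + y (k.2 + 1) * I) '' Icc (x k.1) (x (k.1 + 1)) ⊆
        connectedComponentIn (ball (0 : ℂ) 1 \ closure (poleSet u)) 0)
    (hlef : ∀ k ∈ H, (k.1 - 1, k.2) ∉ H →
      (fun t : ℝ ↦ (x k.1 : ℂ) + t * I) '' Icc (y k.2) (y (k.2 + 1)) ⊆
        connectedComponentIn (ball (0 : ℂ) 1 \ closure (poleSet u)) 0)
    (hrig : ∀ k ∈ H, (k.1 + 1, k.2) ∉ H →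
      (fun t : ℝ ↦ (x (k.1 + 1) : ℂ) + t * I) '' Icc (y k.2) (y (k.2 + 1)) ⊆
        connectedComponentIn (ball (0 : ℂ) 1 \ closure (poleSet u)) 0) :
    ∀ k ∈ H, poleSet u ∩ (Ioo (x k.1) (x (k.1 + 1)) ×ℂ Ioo (y k.2) (y (k.2 + 1))) = ∅ :=
  poleSet_inter_cello_eq_empty hc hre hu hF hr₀ hS hFB isPreconnected_connectedComponentIn
    (zero_mem_component hr₀ hS) (connectedComponentIn_subset _ _) hx hy H hH hoff hbot htop hlef hrig

end Summit.RiemannHypothesis.RiemannHypothesis.Theorems.Splittings.ScrewDust
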